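/-
Copyright (c) 2026 the pub-hodgecm-mathlib formalisation cell (harness21).  Prover seat hodgecm-mathlib-F0P2-p02 (g7), topic T5 = P8
«(C♯)hol interior», row «Cc (3′) S5 TOTALITY FINISH» (A-p19 (g19) closer road note v4, 2026-08-31T22:30Z), 2026-08-31.  KERNEL module:
THEOREMS ONLY (no definition, no named fact, no `sorry`, no instance, no notation).
-/
import Literature.NumberTheory.Automorphic.Liu2021.ThetaLiftFromLinePureTensor
import HarnessLib

/-!
# Node Cc (3′), sub-brick S5: TOTALITY of the pure tensors `E(Φ_∞ ⊗ Φ_f)` for the theta-lift classes `[Θ̃_Φ(f) ∘ ιA]`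

Topic `NumberTheory/Automorphic/Liu2021`; namespace `Literature.NumberTheory.Automorphic.Liu2021`.  KERNEL: theorems only.  Cell hodgecm-mathlib
FLOOR 0, programme P2, topic T5 = P8 «(C♯)hol interior» (`F0/P2/T5a-TREE.md` §2b, node Cc; A-p19 (g19)'s closer road note v4, sub-brick S5
«totality finish»).

The (3′) closer shows, place by place, that the projected theta functional kills every PURE TENSOR `E(Φ_∞ ⊗ Φ_f)`
(`E = piSchwartzBruhatEquiv`, [Tate1967, §3.2]: the standard functions span the adelic Schwartz–Bruhat space) and must conclude that it kills the
class of the seam's `Φ`, which lies in `P` and is non-zero — a contradiction.  This file is that last step, in the two currencies in use: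
the `Fin n′` currency `E_{n′}(a₁ ⊗ f)` of ★ `Def411WeilCarriersArchPlaceOperator` ∕ ★ `ThetaLiftFromLineContinuity.exists_clm_toLp_lineThetaLift_tmul`,
and the reindexed node-B currency `R_{e₁} E_{N × 1}(φ ⊗ Φ_f)` of ★ `rightRegular_finAdelicToAdelic_toLp_lineThetaLift_tensor` (`R_e = piSBReindex`).
Everything is exact linear algebra: `E` and `R_e` are LINEAR EQUIVALENCES onto `𝒮(𝔸^{n′})` (★ `piSchwartzBruhatEquiv`, ★ `piSBReindex`), the class
`Φ ↦ [Θ̃_Φ(f) ∘ ιA]` is `ℂ`-linear (★ `toLp_lineThetaLift_add_left ∕ _smul_left`, Weil's theta distribution is linear [Weil1964, n° 41 Thm 6]), and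
`TensorProduct.induction_on`; no continuity is needed (cf. ★ `exists_tensor_of_apply_toLp_lineThetaLift_ne_zero`, the same statement in the
function-product currency `v ↦ Φ_∞(v_∞) Φ_f(v_f)`).

* `toLp_lineThetaLift_zero` — `[Θ̃_0(f) ∘ ιA] = 0`;
* **`apply_toLp_lineThetaLift_eq_zero_of_forall_tmul`** — a `ℂ`-linear `S` out of `L²([U(H)], ν)` killing the classes of all `E(φ ⊗ Φ_f)` kills the
  class of every `Φ`; **`apply_toLp_lineThetaLift_eq_zero_of_forall_piSBReindex_tmul`** — the same for the pure tensors `R_{e₁} E(φ ⊗ Φ_f)`;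
* `exists_tmul_apply_toLp_lineThetaLift_ne_zero` ∕ `exists_piSBReindex_tmul_apply_toLp_lineThetaLift_ne_zero` — the contrapositives (the closer's
  «`F ∈ P`, `F ≠ 0` ⇒ some pure tensor is seen by `pr_P`»).

HONEST SCOPE.  Nothing of [Liu2021] is asserted; this file books nothing and discharges nothing booked (sub-brick S5 of the in-house node Cc of the
booked letter (C♯)hol).  HC_CM is proved only modulo the printed citations until rung 0 closes.

## References
* [Tate1967] J. Tate, *Fourier analysis in number fields and Hecke's zeta-functions*, in Cassels–Fröhlich (1967), §3.2, §4.2 (standard =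
  factorizable Schwartz–Bruhat functions span).
* [Weil1964] A. Weil, *Sur certains groupes d'opérateurs unitaires*, Acta Math. 111 (1964), Chap. III n° 41 Thm 6 p. 193 (the theta
  distribution is linear).
* [Liu2021] Y. Liu, Camb. J. Math. 9 (2021) = arXiv:2102.11518, proof of Prop. 4.13 Case 1 (l. 2137–2141, p. 48).
-/

set_option autoImplicit false

noncomputable section

open NumberField MeasureTheory IsDedekindDomain
open scoped Matrix Kronecker ComplexOrder ENNReal SchwartzMap TensorProduct Classical

namespace Literature.NumberTheory.Automorphic.Liu2021

open _root_.MeasureTheory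
open Literature.NumberTheory.Automorphic Literature.NumberTheory.Automorphic.UnitaryGroup
open Literature.NumberTheory.Automorphic.UnitaryGroup.CotangentForms
open Literature.NumberTheory.Automorphic.IdeleClassGroup
open Literature.NumberTheory.Automorphic.Liu2021.Def411WeilCarriers
open Literature.NumberTheory.Automorphic.Liu2021.Def411WeilCarriersDoubling
open Literature.NumberTheory.GelbartRogawski1991 Literature.NumberTheory.GelbartRogawski1991.UnitaryDualPair
open Literature.NumberTheory.Weil1964
open Literature.RepresentationTheory.Liu2021
open Literature.RepresentationTheory.CompactGroups
open Literature.RepresentationTheory.HeisenbergGroup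

section Lift

variable (L : Type) [Field L] [NumberField L] [IsCMField L] (N : ℕ) (H : Matrix (Fin N) (Fin N) L)
  {n' : ℕ} (e₁ : Fin N × Fin 1 ≃ Fin n') (dV : Fin N → L) (hdV : ∀ i, IsCMField.complexConj L (dV i) = dV i)
  (hdV0 : ∀ i, dV i ≠ 0) (g : GL (Fin N) L)
  (hg : ((g : Matrix (Fin N) (Fin N) L).map (cmConjRingHom L))ᵀ * H * (g : Matrix (Fin N) (Fin N) L) = Matrix.diagonal dV)
  (μ : Literature.NumberTheory.Automorphic.IdeleClassGroup L →ₜ* Circle) (hμ : IsConjugateSymplectic L μ) (a : (↥(maximalRealSubfield L))ˣ)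
  (hρ : HasThetaMajorants fun
      (p : ↥(UnitaryGroup.adelic (↥(maximalRealSubfield L)) L (IsCMField.complexConj L) N (Matrix.diagonal dV)) × ↥(UnitaryGroup.adelic (↥(maximalRealSubfield L)) L (IsCMField.complexConj L) 1 (JW (↥(maximalRealSubfield L)) L a))) (Φ : piSchwartzBruhat (↥(maximalRealSubfield L)) (Fin n')) =>
        pairRep (↥(maximalRealSubfield L)) L (IsCMField.complexConj L) N 1 e₁ (Matrix.diagonal dV) (JW (↥(maximalRealSubfield L)) L a)
          (chiSplittingLine L e₁ dV hdV hdV0 (toHeckeCharacter L μ) (isUnitary_toHeckeCharacter L μ)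
            ((isOscillatorChar_toHeckeCharacter_iff μ).mpr hμ) (TW (↥(maximalRealSubfield L)) a)
            (isUnit_det_TW (↥(maximalRealSubfield L)) a) (JW (↥(maximalRealSubfield L)) L a) (JW_eq (↥(maximalRealSubfield L)) L a))
          p Φ)
  [CompactSpace (↥(UnitaryGroup.adelic (↥(maximalRealSubfield L)) L (IsCMField.complexConj L) N (Matrix.diagonal dV)) ⧸ (UnitaryGroup.toAdelic (↥(maximalRealSubfield L)) L (IsCMField.complexConj L) N (Matrix.diagonal dV)).range)] [MeasurableSpace (↥(UnitaryGroup.adelic (↥(maximalRealSubfield L)) L (IsCMField.complexConj L) 1 (JW (↥(maximalRealSubfield L)) L a)) ⧸ (UnitaryGroup.toAdelic (↥(maximalRealSubfield L)) L (IsCMField.complexConj L) 1 (JW (↥(maximalRealSubfield L)) L a)).range)] (μW : Measure (↥(UnitaryGroup.adelic (↥(maximalRealSubfield L)) L (IsCMField.complexConj L) 1 (JW (↥(maximalRealSubfield L)) L a)) ⧸ (UnitaryGroup.toAdelic (↥(maximalRealSubfield L)) L (IsCMField.complexConj L) 1 (JW (↥(maximalRealSubfield L)) L a)).range))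
  (f : C((↥(UnitaryGroup.adelic (↥(maximalRealSubfield L)) L (IsCMField.complexConj L) 1 (JW (↥(maximalRealSubfield L)) L a)) ⧸ (UnitaryGroup.toAdelic (↥(maximalRealSubfield L)) L (IsCMField.complexConj L) 1 (JW (↥(maximalRealSubfield L)) L a)).range), ℂ))
  [BorelSpace (↥(UnitaryGroup.adelic (↥(maximalRealSubfield L)) L (IsCMField.complexConj L) 1 (JW (↥(maximalRealSubfield L)) L a)) ⧸ (UnitaryGroup.toAdelic (↥(maximalRealSubfield L)) L (IsCMField.complexConj L) 1 (JW (↥(maximalRealSubfield L)) L a)).range)] [IsFiniteMeasure μW]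
  [CompactSpace (adelicGroupData (↥(maximalRealSubfield L)) L (IsCMField.complexConj L) N H).automorphicQuotient]
  (ν : Measure (adelicGroupData (↥(maximalRealSubfield L)) L (IsCMField.complexConj L) N H).automorphicQuotient) [IsFiniteMeasure ν]

omit [BorelSpace (↥(UnitaryGroup.adelic (↥(maximalRealSubfield L)) L (IsCMField.complexConj L) 1 (JW (↥(maximalRealSubfield L)) L a)) ⧸ (UnitaryGroup.toAdelic (↥(maximalRealSubfield L)) L (IsCMField.complexConj L) 1 (JW (↥(maximalRealSubfield L)) L a)).range)] [IsFiniteMeasure μW] in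
/-- **`[Θ̃_0(f) ∘ ιA] = 0`** (the class of the zero Schwartz–Bruhat function vanishes; `0 = 0 • 0` and ★ `toLp_lineThetaLift_smul_left`).
[cite: Weil1964, Chap. III n° 41 Thm 6 p. 193] -/
theorem toLp_lineThetaLift_zero :
    MemLp.toLp _ (memLp_toQuotFun_lineThetaLift L N H e₁ dV hdV hdV0 g hg μ hμ a hρ μW (0 : piSchwartzBruhat (↥(maximalRealSubfield L)) (Fin n')) f ν 2) = 0 := by
  have h := toLp_lineThetaLift_smul_left L N H e₁ dV hdV hdV0 g hg μ hμ a hρ μW f ν (0 : ℂ) (0 : piSchwartzBruhat (↥(maximalRealSubfield L)) (Fin n'))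
  rw [zero_smul] at h
  rw [h, zero_smul]

/-- **TOTALITY OF THE PURE TENSORS `E(Φ_∞ ⊗ Φ_f)` (`Fin n′` currency).**  If a `ℂ`-linear map `S` out of `L²([U(H)], ν)` kills the class
`[Θ̃_{E(φ ⊗ Φ_f)}(f) ∘ ιA]` of every pure tensor (`E = piSchwartzBruhatEquiv`, a linear equivalence `𝓢(X_∞) ⊗ 𝒮(𝔸_f^{n′}) ≃ 𝒮(𝔸^{n′})`), then it kills the class
of EVERY Schwartz–Bruhat `Φ`: the class is `ℂ`-linear in `Φ` (★ `toLp_lineThetaLift_add_left ∕ _smul_left`) and pure tensors span (`TensorProduct.induction_on`).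
No continuity of `S` is used. [cite: Tate1967, §3.2, §4.2] [cite: Weil1964, Chap. III n° 41 Thm 6 p. 193] -/
theorem apply_toLp_lineThetaLift_eq_zero_of_forall_tmul {X : Type*} [AddCommGroup X] [Module ℂ X] (S : Lp ℂ 2 ν →ₗ[ℂ] X)
    (h : ∀ (φ : 𝓢((Fin n' → mixedEmbedding.mixedSpace ↥(maximalRealSubfield L)), ℂ)) (Φf : FinSB (↥(maximalRealSubfield L)) (Fin n')),
      S (MemLp.toLp _ (memLp_toQuotFun_lineThetaLift L N H e₁ dV hdV hdV0 g hg μ hμ a hρ μW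
        (piSchwartzBruhatEquiv (↥(maximalRealSubfield L)) (Fin n') (φ ⊗ₜ[ℂ] Φf)) f ν 2)) = 0)
    (Φ : piSchwartzBruhat (↥(maximalRealSubfield L)) (Fin n')) :
    S (MemLp.toLp _ (memLp_toQuotFun_lineThetaLift L N H e₁ dV hdV hdV0 g hg μ hμ a hρ μW Φ f ν 2)) = 0 := by
  -- the functional `Ψ ↦ S [Θ̃_Ψ(f) ∘ ιA]` on the Schwartz–Bruhat space
  let F : piSchwartzBruhat (↥(maximalRealSubfield L)) (Fin n') → X := fun Ψ =>
    S (MemLp.toLp _ (memLp_toQuotFun_lineThetaLift L N H e₁ dV hdV hdV0 g hg μ hμ a hρ μW Ψ f ν 2))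
  have hadd : ∀ Ψ₁ Ψ₂, F (Ψ₁ + Ψ₂) = F Ψ₁ + F Ψ₂ := fun Ψ₁ Ψ₂ => by
    simp only [F]
    rw [toLp_lineThetaLift_add_left L N H e₁ dV hdV hdV0 g hg μ hμ a hρ μW f ν Ψ₁ Ψ₂, map_add]
  have hzero : F 0 = 0 := by
    simp only [F]
    rw [toLp_lineThetaLift_zero L N H e₁ dV hdV hdV0 g hg μ hμ a hρ μW f ν, map_zero]
  have key : ∀ x : 𝓢((Fin n' → mixedEmbedding.mixedSpace ↥(maximalRealSubfield L)), ℂ) ⊗[ℂ] FinSB (↥(maximalRealSubfield L)) (Fin n'),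
      F (piSchwartzBruhatEquiv (↥(maximalRealSubfield L)) (Fin n') x) = 0 := fun x => by
    induction x using TensorProduct.induction_on with
    | zero => rw [map_zero]; exact hzero
    | tmul φ Φf => exact h φ Φf
    | add x y hx hy => rw [map_add, hadd, hx, hy, add_zero]
  have hΦ : Φ = piSchwartzBruhatEquiv (↥(maximalRealSubfield L)) (Fin n') ((piSchwartzBruhatEquiv (↥(maximalRealSubfield L)) (Fin n')).symm Φ) :=
    ((piSchwartzBruhatEquiv (↥(maximalRealSubfield L)) (Fin n')).apply_symm_apply Φ).symm
  rw [hΦ]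
  exact key _

/-- **TOTALITY OF THE PURE TENSORS `R_{e₁} E(φ ⊗ Φ_f)` (reindexed node-B currency, `R_e = piSBReindex`, `E = piSchwartzBruhatEquiv` on `Fin N × Fin 1`).**
If a `ℂ`-linear `S` out of `L²([U(H)], ν)` kills `[Θ̃_{R_{e₁} E(φ ⊗ Φ_f)}(f) ∘ ιA]` for all `φ`, `Φ_f`, it kills `[Θ̃_Φ(f) ∘ ιA]` for every `Φ ∈ 𝒮(𝔸^{n′})` (`R_{e₁} ∘ E` is a
linear equivalence onto `𝒮(𝔸^{n′})`). [cite: Tate1967, §3.2, §4.2] [cite: Weil1964, Chap. III n° 41 Thm 6 p. 193] -/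
theorem apply_toLp_lineThetaLift_eq_zero_of_forall_piSBReindex_tmul {X : Type*} [AddCommGroup X] [Module ℂ X] (S : Lp ℂ 2 ν →ₗ[ℂ] X)
    (h : ∀ (φ : 𝓢(((Fin N × Fin 1) → mixedEmbedding.mixedSpace ↥(maximalRealSubfield L)), ℂ)) (Φf : FinSB (↥(maximalRealSubfield L)) (Fin N × Fin 1)),
      S (MemLp.toLp _ (memLp_toQuotFun_lineThetaLift L N H e₁ dV hdV hdV0 g hg μ hμ a hρ μW
        (piSBReindex (↥(maximalRealSubfield L)) e₁
          (piSchwartzBruhatEquiv (↥(maximalRealSubfield L)) (Fin N × Fin 1) (φ ⊗ₜ[ℂ] Φf))) f ν 2)) = 0)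
    (Φ : piSchwartzBruhat (↥(maximalRealSubfield L)) (Fin n')) :
    S (MemLp.toLp _ (memLp_toQuotFun_lineThetaLift L N H e₁ dV hdV hdV0 g hg μ hμ a hρ μW Φ f ν 2)) = 0 := by
  let F : piSchwartzBruhat (↥(maximalRealSubfield L)) (Fin n') → X := fun Ψ =>
    S (MemLp.toLp _ (memLp_toQuotFun_lineThetaLift L N H e₁ dV hdV hdV0 g hg μ hμ a hρ μW Ψ f ν 2))
  have hadd : ∀ Ψ₁ Ψ₂, F (Ψ₁ + Ψ₂) = F Ψ₁ + F Ψ₂ := fun Ψ₁ Ψ₂ => by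
    simp only [F]
    rw [toLp_lineThetaLift_add_left L N H e₁ dV hdV hdV0 g hg μ hμ a hρ μW f ν Ψ₁ Ψ₂, map_add]
  have hzero : F 0 = 0 := by
    simp only [F]
    rw [toLp_lineThetaLift_zero L N H e₁ dV hdV hdV0 g hg μ hμ a hρ μW f ν, map_zero]
  have key : ∀ x : 𝓢(((Fin N × Fin 1) → mixedEmbedding.mixedSpace ↥(maximalRealSubfield L)), ℂ) ⊗[ℂ] FinSB (↥(maximalRealSubfield L)) (Fin N × Fin 1),
      F (piSBReindex (↥(maximalRealSubfield L)) e₁ (piSchwartzBruhatEquiv (↥(maximalRealSubfield L)) (Fin N × Fin 1) x)) = 0 := fun x => by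
    induction x using TensorProduct.induction_on with
    | zero => rw [map_zero, map_zero]; exact hzero
    | tmul φ Φf => exact h φ Φf
    | add x y hx hy => rw [map_add, map_add, hadd, hx, hy, add_zero]
  have hΦ : Φ = piSBReindex (↥(maximalRealSubfield L)) e₁ (piSchwartzBruhatEquiv (↥(maximalRealSubfield L)) (Fin N × Fin 1)
      ((piSchwartzBruhatEquiv (↥(maximalRealSubfield L)) (Fin N × Fin 1)).symm ((piSBReindex (↥(maximalRealSubfield L)) e₁).symm Φ))) := by
    rw [LinearEquiv.apply_symm_apply, LinearEquiv.apply_symm_apply]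
  rw [hΦ]
  exact key _

/-- **A non-zero value on some class is a non-zero value on the class of a PURE TENSOR `E(φ ⊗ Φ_f)`** (`Fin n′` currency; contrapositive of
`apply_toLp_lineThetaLift_eq_zero_of_forall_tmul`) — the (3′) closer's «`F = [Θ̃_Φ(f) ∘ ιA] ∈ P`, `F ≠ 0` ⇒ `pr_P` sees some `E(φ ⊗ Φ_f)`».
[cite: Tate1967, §3.2, §4.2] [cite: Liu2021, proof of Prop. 4.13 Case 1 (l. 2137–2141, p. 48)] -/
theorem exists_tmul_apply_toLp_lineThetaLift_ne_zero {X : Type*} [AddCommGroup X] [Module ℂ X] (S : Lp ℂ 2 ν →ₗ[ℂ] X)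
    (Φ : piSchwartzBruhat (↥(maximalRealSubfield L)) (Fin n'))
    (hΦ : S (MemLp.toLp _ (memLp_toQuotFun_lineThetaLift L N H e₁ dV hdV hdV0 g hg μ hμ a hρ μW Φ f ν 2)) ≠ 0) :
    ∃ (φ : 𝓢((Fin n' → mixedEmbedding.mixedSpace ↥(maximalRealSubfield L)), ℂ)) (Φf : FinSB (↥(maximalRealSubfield L)) (Fin n')),
      S (MemLp.toLp _ (memLp_toQuotFun_lineThetaLift L N H e₁ dV hdV hdV0 g hg μ hμ a hρ μW
        (piSchwartzBruhatEquiv (↥(maximalRealSubfield L)) (Fin n') (φ ⊗ₜ[ℂ] Φf)) f ν 2)) ≠ 0 := by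
  by_contra hcon
  push Not at hcon
  exact hΦ (apply_toLp_lineThetaLift_eq_zero_of_forall_tmul L N H e₁ dV hdV hdV0 g hg μ hμ a hρ μW f ν S hcon Φ)

/-- **A non-zero value on some class is a non-zero value on the class of a PURE TENSOR `R_{e₁} E(φ ⊗ Φ_f)`** (node-B currency; contrapositive of
`apply_toLp_lineThetaLift_eq_zero_of_forall_piSBReindex_tmul`). [cite: Tate1967, §3.2, §4.2] [cite: Liu2021, proof of Prop. 4.13 Case 1 (l. 2137–2141, p. 48)] -/
theorem exists_piSBReindex_tmul_apply_toLp_lineThetaLift_ne_zero {X : Type*} [AddCommGroup X] [Module ℂ X] (S : Lp ℂ 2 ν →ₗ[ℂ] X)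
    (Φ : piSchwartzBruhat (↥(maximalRealSubfield L)) (Fin n'))
    (hΦ : S (MemLp.toLp _ (memLp_toQuotFun_lineThetaLift L N H e₁ dV hdV hdV0 g hg μ hμ a hρ μW Φ f ν 2)) ≠ 0) :
    ∃ (φ : 𝓢(((Fin N × Fin 1) → mixedEmbedding.mixedSpace ↥(maximalRealSubfield L)), ℂ)) (Φf : FinSB (↥(maximalRealSubfield L)) (Fin N × Fin 1)),
      S (MemLp.toLp _ (memLp_toQuotFun_lineThetaLift L N H e₁ dV hdV hdV0 g hg μ hμ a hρ μW
        (piSBReindex (↥(maximalRealSubfield L)) e₁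
          (piSchwartzBruhatEquiv (↥(maximalRealSubfield L)) (Fin N × Fin 1) (φ ⊗ₜ[ℂ] Φf))) f ν 2)) ≠ 0 := by
  by_contra hcon
  push Not at hcon
  exact hΦ (apply_toLp_lineThetaLift_eq_zero_of_forall_piSBReindex_tmul L N H e₁ dV hdV hdV0 g hg μ hμ a hρ μW f ν S hcon Φ)

end Lift

end Literature.NumberTheory.Automorphic.Liu2021

end
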